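import Summits.QuantumFields.YangMills.Theses.SlackWindow
import Summits.QuantumFields.YangMills.Theorems.SlackWindowCarrierSlackLargeTransfer
import HarnessLib

/-!
# Route `SlackWindow` (rev 7, ym-idea-11 g11 LINE 2 «pointwise-from-smeared under the cone»): the glue `ConeSplitGlue`
# (stmt-QuantumFields-23815), PROVED BY NAME

`ConeSplitGlue : SpectralCone → CarrierAtomicRPBound → ConeLargeTorusTransfer → CarrierSlackLargeMirrorCeiling` — the glue of the
split of the deciding crux `CarrierSlackLargeMirrorCeiling` (stmt-QuantumFields-23686) into SIZE (`CarrierAtomicRPBound`) and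
LOCALISATION (`SpectralCone`, shared with `OnsetTautology`): the transfer support `ConeLargeTorusTransfer` yields
`SlackLargeMirrorCeiling`, and the landed edge `SlackWindow.carrierSlackLargeMirrorCeiling_of_slackLargeMirrorCeiling`
(`Theorems/SlackWindowCarrierSlackLargeTransfer.lean` ✓) pins the carrier.  Definitional glue, exactly the planner's term.
Width seat `ym-line-sfw-p2-w4` g19 (cell ym-idea-1; free hands), `--workitem stmt-QuantumFields-23815`.
HONEST FRAMING: `SpectralCone`, `CarrierAtomicRPBound`, `ConeLargeTorusTransfer` stay OPEN; no crux, leaf, rung or summit is proved;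
the Yang–Mills mass gap is NOT proved. [folklore]
-/

set_option autoImplicit false

namespace Summit.QuantumFields.YangMills.Theorems.SlackWindow

open Summit.QuantumFields.YangMills.Theses.SlackWindow

/-- **`SlackWindow.ConeSplitGlue`** (stmt-QuantumFields-23815), BY NAME: children ⟹ parent through the transfer support and the landed
carrier edge. [folklore] -/
theorem coneSplitGlue_proof : Summit.QuantumFields.YangMills.Theses.SlackWindow.ConeSplitGlue :=
  fun hK hB hT => carrierSlackLargeMirrorCeiling_of_slackLargeMirrorCeiling (hT hK hB)

end Summit.QuantumFields.YangMills.Theorems.SlackWindow
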